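import Literature.Geometry.Kaehler.ComplexTorusIntegralHodgeLatticePrimitiveSplittingSaturation
import HarnessLib

/-!
# The saturation theorem at the two ends: `(NS(X)_prim)^⊥ = (ℤθ)^{sat}` in `NS(X)` and
# `(Hdg²(X, ℤ)_prim)^⊥ = (θ ∧ NS(X))^{sat}` in `Hdg²(X, ℤ)`

Layer `Literature/Geometry/Kaehler`, namespace `Literature.Geometry.Kaehler.ComplexTorus`; lane `lit-hodgefound`
(Track 2 foundations library), seat p09, generation 46, row g46-#12. THEOREMS ONLY (0 definitions); no named fact, net debt 0.
The two explicit instances of g46-#11 (`ComplexTorusIntegralHodgeLatticePrimitiveSplittingSaturation`: inside `Hdgᵖ⁺¹(X, ℤ)` the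
`B_{2p+2}`-orthogonal of the primitive Hodge lattice is the saturation of `θ ∧ Hdgᵖ(X, ℤ)`), where `Hdgᵖ(X, ℤ)` is known:

* `p = 0` (§1, `Hdg⁰(X, ℤ) = H⁰(X, ℤ) = ℤ·1`): in `NS(X) ≅ Hdg¹(X, ℤ)` with the Lefschetz form `B₂ = ⟨·, γ_{g−2} ∧ ·⟩`, an integral class is
  `B₂`-orthogonal to the primitive Néron–Severi lattice `NS(X)_prim` **iff a positive multiple of it is an integral multiple of `θ`**:
  `(NS(X)_prim)^⊥ = (ℤθ)^{sat}`, the saturation of the polarisation class (a line: g46-#10).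
* `p = 1` (§2, `Hdg¹(X, ℤ) = NS(X)`, Lefschetz `(1,1)`): in `Hdg²(X, ℤ)` with `B₄ = ⟨·, γ_{g−4} ∧ ·⟩` (`g ≥ 4`; the cup product on an abelian
  fourfold), an integral Hodge class is orthogonal to `Hdg²(X, ℤ)_prim` **iff a positive multiple of it is `E ∧ θ` with `E ∈ NS(X)`**:
  `(Hdg²(X, ℤ)_prim)^⊥ = (θ ∧ NS(X))^{sat}` (rank `ρ(X)`, signature `(1, ρ(X) − 1)` on a fourfold: g46-#10).

## References

* [cite: VoisinHodgeI2002, §6.3.2 Lemma 6.31, Thm. 6.32 (PDF p. 128); §7.1.2 (PDF p. 134); §11.3.2–11.3.3 (Lefschetz (1,1))]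
* [cite: Lange2023AbelianVarietiesComplex, §1.3.1; §5.4.1 (5.22) (PDF p. 275); §7.3.2 (3)]
* [cite: Kitaoka1993, Ch. 5 Prop. 5.3.3 (proof)]
-/

noncomputable section

-- `Module ℂ` / `SMulZeroClass ℂ` synthesis on `E [⋀^Fin k]→L[ℝ] ℂ` (as in `ComplexTorusLefschetzDecomposition`)
set_option maxSynthPendingDepth 3

open Module Function Complex
open LinearMap (BilinForm)
open Literature.LinearAlgebra.Alternating
open Literature.Analysis.Complex (IsOfTypeAt typeSubmodule oneForm₀)

namespace Literature.Geometry.Kaehler.ComplexTorus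

/-! ## §1 `p = 0`: `(NS(X)_prim)^⊥ = (ℤθ)^{sat}` -/

section NeronSeveri

variable {ι : Type*} [Fintype ι] [DecidableEq ι] {E : Type*} [NormedAddCommGroup E] [NormedSpace ℂ E]
  {Φ : (ι → ℝ) ≃L[ℝ] E} {j n q : ℕ} {η : E [⋀^Fin 2]→L[ℝ] ℝ} {d : Fin (j + 2) → ℕ}

omit [Fintype ι] [DecidableEq ι] in
/-- `1 ∧ θ = θ` for the unit `0`-form. [folklore] -/
private theorem oneForm₀_wedge_two₈₂ (θ : E [⋀^Fin 2]→L[ℝ] ℂ) : (oneForm₀ E).wedge θ = θ := by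
  rw [oneForm₀, ContinuousAlternatingMap.constOfIsEmpty_one_wedge]
  ext v
  rfl

omit [Fintype ι] [DecidableEq ι] in
/-- `H⁰(X, ℤ) = ℤ·1`: an integral `0`-form is an integral multiple of the unit `0`-form. [folklore] -/
private theorem exists_eq_intCast_smul_oneForm₀₈₂ {β : E [⋀^Fin 0]→L[ℝ] ℂ} (hβ : β ∈ integralForms Φ 0) :
    ∃ c : ℤ, β = (c : ℂ) • oneForm₀ E := by
  obtain ⟨c, hc⟩ := hβ Fin.elim0
  refine ⟨c, ?_⟩
  ext v
  rw [ContinuousAlternatingMap.smul_apply, Literature.Analysis.Complex.oneForm₀_apply, smul_eq_mul, mul_one,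
    Subsingleton.elim v (latticeTuple Φ Fin.elim0), hc]

set_option maxHeartbeats 4000000 in
/-- **`(NS(X)_prim)^⊥ = (ℤθ)^{sat}`**: inside `NS(X) ≅ Hdg¹(X, ℤ)` with the Lefschetz form `B₂ = ⟨·, γ_{g−2} ∧ ·⟩`, an integral class `x` is
`B₂`-orthogonal to every primitive class **iff `N·x = c·θ` for some `N ≥ 1`, `c ∈ ℤ`** (g46-#11 at `p = 0` with `Hdg⁰(X, ℤ) = ℤ·1`).
[cite: VoisinHodgeI2002, §6.3.2 Lemma 6.31, Thm. 6.32 (PDF p. 128)] [cite: Lange2023AbelianVarietiesComplex, §5.4.1 (5.22) (PDF p. 275); §7.3.2 (3)] -/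
theorem IsPolarizationType.mem_orthogonal_primitive_iff_exists_nsmul_eq_zsmul_ofRealForm (hd : IsPolarizationType Φ η d)
    (hη : IsRiemannForm Φ η) (hkq : 2 + q = j + 2) (hq : q ≤ j + 2) {γ : E [⋀^Fin (2 * q)]→L[ℝ] ℂ}
    (hγ : wedgePow (ofRealForm η) q = ((q.factorial * ∏ i : Fin q, d (Fin.castLE hq i) : ℕ) : ℂ) • γ)
    (e : Fin n ≃ ι) (hn : 2 + (2 * q + 2) = n) {B : BilinForm ℤ ↥(integralForms Φ 2)}
    (hB : ∀ x y : ↥(integralForms Φ 2),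
      ((B x y : ℤ) : ℂ) = poincarePairing Φ e hn (x : E [⋀^Fin 2]→L[ℝ] ℂ) (γ.wedge (y : E [⋀^Fin 2]→L[ℝ] ℂ)))
    {P : Submodule ℤ ↥(AddSubgroup.toIntSubmodule ((integralHodgeClassesIn Φ 2 1).addSubgroupOf (integralForms Φ 2)))}
    (hP : ∀ z, z ∈ P ↔ (((z : ↥(AddSubgroup.toIntSubmodule ((integralHodgeClassesIn Φ 2 1).addSubgroupOf
      (integralForms Φ 2)))) : ↥(integralForms Φ 2)) : E [⋀^Fin 2]→L[ℝ] ℂ) ∈ primitiveForms η 2)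
    (x : ↥(AddSubgroup.toIntSubmodule ((integralHodgeClassesIn Φ 2 1).addSubgroupOf (integralForms Φ 2)))) :
    x ∈ (B.restrict (AddSubgroup.toIntSubmodule ((integralHodgeClassesIn Φ 2 1).addSubgroupOf
        (integralForms Φ 2)))).orthogonal P ↔
      ∃ N : ℕ, 0 < N ∧ ∃ c : ℤ,
        (N : ℂ) • ((x : ↥(integralForms Φ 2)) : E [⋀^Fin 2]→L[ℝ] ℂ) = (c : ℂ) • (ofRealForm η : E [⋀^Fin 2]→L[ℝ] ℂ) := by
  rw [hd.mem_orthogonal_primitive_iff_exists_nsmul_eq_wedge_ofRealForm (p := 0) hη hkq hq hγ e hn hB hP x]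
  refine ⟨?_, ?_⟩
  · rintro ⟨N, hN, β, hβH, hNx⟩
    obtain ⟨c, hc⟩ := exists_eq_intCast_smul_oneForm₀₈₂ (Φ := Φ) hβH.1
    refine ⟨N, hN, c, ?_⟩
    rw [hNx, hc, wedge_smul_left_complex, oneForm₀_wedge_two₈₂]
  · rintro ⟨N, hN, c, hNx⟩
    refine ⟨N, hN, (c : ℂ) • oneForm₀ E, ?_, ?_⟩
    · rw [Int.cast_smul_eq_zsmul ℂ c]
      exact AddSubgroup.zsmul_mem _ (oneForm₀_mem_integralHodgeClasses Φ) c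
    · rw [hNx, wedge_smul_left_complex, oneForm₀_wedge_two₈₂]

end NeronSeveri

/-! ## §2 `p = 1`: `(Hdg²(X, ℤ)_prim)^⊥ = (θ ∧ NS(X))^{sat}` -/

section CodimensionTwo

variable {ι : Type*} [Fintype ι] [DecidableEq ι] {E : Type*} [NormedAddCommGroup E] [NormedSpace ℂ E]
  {Φ : (ι → ℝ) ≃L[ℝ] E} {j n q : ℕ} {η : E [⋀^Fin 2]→L[ℝ] ℝ} {d : Fin (j + 2) → ℕ}

set_option maxHeartbeats 4000000 in
/-- **`(Hdg²(X, ℤ)_prim)^⊥ = (θ ∧ NS(X))^{sat}`**: inside `Hdg²(X, ℤ) ⊂ H⁴(X, ℤ)` with the Lefschetz form `B₄ = ⟨·, γ_{g−4} ∧ ·⟩` (`g ≥ 4`; on an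
abelian fourfold the cup product), an integral Hodge class `x` of codimension `2` is `B₄`-orthogonal to every primitive one **iff
`N·x = E ∧ θ` for some `N ≥ 1` and some `E ∈ NS(X)`** (g46-#11 at `p = 1` with Lefschetz `(1,1)`: `Hdg¹(X, ℤ) = NS(X)`).
[cite: VoisinHodgeI2002, §6.3.2 Lemma 6.31, Thm. 6.32 (PDF p. 128); §7.1.2 (PDF p. 134)] [cite: Lange2023AbelianVarietiesComplex, §1.3.1; §5.4.1 (5.22); §7.3.2 (3)] -/
theorem IsPolarizationType.mem_orthogonal_primitive_iff_exists_nsmul_eq_ofRealForm_wedge (hd : IsPolarizationType Φ η d)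
    (hη : IsRiemannForm Φ η) (hkq : 4 + q = j + 2) (hq : q ≤ j + 2) {γ : E [⋀^Fin (2 * q)]→L[ℝ] ℂ}
    (hγ : wedgePow (ofRealForm η) q = ((q.factorial * ∏ i : Fin q, d (Fin.castLE hq i) : ℕ) : ℂ) • γ)
    (e : Fin n ≃ ι) (hn : 4 + (2 * q + 4) = n) {B : BilinForm ℤ ↥(integralForms Φ 4)}
    (hB : ∀ x y : ↥(integralForms Φ 4),
      ((B x y : ℤ) : ℂ) = poincarePairing Φ e hn (x : E [⋀^Fin 4]→L[ℝ] ℂ) (γ.wedge (y : E [⋀^Fin 4]→L[ℝ] ℂ)))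
    {P : Submodule ℤ ↥(AddSubgroup.toIntSubmodule ((integralHodgeClassesIn Φ 4 2).addSubgroupOf (integralForms Φ 4)))}
    (hP : ∀ z, z ∈ P ↔ (((z : ↥(AddSubgroup.toIntSubmodule ((integralHodgeClassesIn Φ 4 2).addSubgroupOf
      (integralForms Φ 4)))) : ↥(integralForms Φ 4)) : E [⋀^Fin 4]→L[ℝ] ℂ) ∈ primitiveForms η 4)
    (x : ↥(AddSubgroup.toIntSubmodule ((integralHodgeClassesIn Φ 4 2).addSubgroupOf (integralForms Φ 4)))) :
    x ∈ (B.restrict (AddSubgroup.toIntSubmodule ((integralHodgeClassesIn Φ 4 2).addSubgroupOf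
        (integralForms Φ 4)))).orthogonal P ↔
      ∃ N : ℕ, 0 < N ∧ ∃ ψ ∈ neronSeveriGroup Φ,
        (N : ℂ) • ((x : ↥(integralForms Φ 4)) : E [⋀^Fin 4]→L[ℝ] ℂ) =
          (ofRealForm ψ : E [⋀^Fin 2]→L[ℝ] ℂ).wedge (ofRealForm η : E [⋀^Fin 2]→L[ℝ] ℂ) := by
  rw [hd.mem_orthogonal_primitive_iff_exists_nsmul_eq_wedge_ofRealForm (p := 1) hη hkq hq hγ e hn hB hP x]
  refine ⟨?_, ?_⟩
  · rintro ⟨N, hN, β, hβH, hNx⟩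
    obtain ⟨ψ, hψ, hψβ⟩ := (mem_integralHodgeClasses_one_iff_exists Φ).1 hβH
    exact ⟨N, hN, ψ, hψ, by rw [hNx, hψβ]⟩
  · rintro ⟨N, hN, ψ, hψ, hNx⟩
    exact ⟨N, hN, ofRealForm ψ, (mem_integralHodgeClasses_one_iff_exists Φ).2 ⟨ψ, hψ, rfl⟩, hNx⟩

end CodimensionTwo

end Literature.Geometry.Kaehler.ComplexTorus

end
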